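import Summits.KontsevichZagierPeriods.KontsevichZagierPeriods.Theorems.LinRedNormalFormArrangementNormalFormStubRebaseSimpleZeroManyChainDissect

/-!
# Stub `stub_rebaseSimpleZeroMany`, part `rebaseSimpleZeroMany_common` (crux `ArrangementNormalForm`,
line `janus-bands`) — brick `ChainPerm`

**Chains in an arbitrary order of the fibre indices.** A literal `GS 0 (n + 1)` datum whose
linking pattern is the chain `A < t_{σ⁻¹ 0} < t_{σ⁻¹ 1} < ⋯ < t_{σ⁻¹ n} < B` for a permutation
`σ` of the fibre indices (the fibre `i` sits at the position `σ i`: bounds `RebaseChain.plo σ A`,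
`RebaseChain.phi σ B`) is reduced to the clean chain in index order by the coordinate
permutation `RebaseChain.permIdx σ` (rule 2, `KZ.IntegralRep.reindex`,
`KZ.of_sub_of_reindex_mem_relations`): the letters are permuted, the common letter slope is
kept. Hence (`RebaseChain.goodM_permChain`) such data with letters of a common `y`-slope are
congruent modulo `KZ.relations` to the subgroup generated by `GG 0 2 (n + 1)` and the mixed
pinch configurations `RebaseChain.mixedSet n` (brick `ChainDissect`).
Registered: `rebaseSimpleZeroMany_permChainMixed`.

References: M. Kontsevich, D. Zagier, *Periods* (2001), §1.2, rule (2).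
-/

noncomputable section

open Set MeasureTheory MvPolynomial
open Literature.NumberTheory.Transcendental Literature.ModelTheory.ExponentialFields

namespace Summit.KontsevichZagierPeriods.ArrangementNormalForm.JanusBands

namespace RebaseChain

open SeparatePos RebasePos RebaseZero RebaseNest

variable {n : ℕ}

/-! ### Permuting the fibres -/

/-- The coordinate permutation of `ℝ^{1 + (n + 1)}` fixing the base and permuting the fibres by
`σ`. [folklore] -/
def permIdx (σ : Equiv.Perm (Fin (n + 1))) : Equiv.Perm (Fin (0 + 1 + (n + 1))) :=
  finSumFinEquiv.symm.trans ((Equiv.sumCongr (Equiv.refl (Fin (0 + 1))) σ).trans finSumFinEquiv)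

variable (σ : Equiv.Perm (Fin (n + 1)))

/-- `permIdx` fixes the base coordinate. -/
@[simp] theorem permIdx_castAdd (j : Fin (0 + 1)) :
    permIdx σ (Fin.castAdd (n + 1) j) = Fin.castAdd (n + 1) j := by
  simp [permIdx]

/-- `permIdx` permutes the fibre coordinates. -/
@[simp] theorem permIdx_natAdd (l : Fin (n + 1)) :
    permIdx σ (Fin.natAdd (0 + 1) l) = Fin.natAdd (0 + 1) (σ l) := by
  simp [permIdx]

/-- The base coordinate after the permutation. -/
theorem yv_permIdx (w : Fin (0 + 1 + (n + 1)) → ℝ) : yv (fun i => w (permIdx σ i)) = yv w := by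
  simp only [yv, yIdx, permIdx_castAdd]

/-- The fibre coordinates after the permutation. -/
theorem tv_permIdx (w : Fin (0 + 1 + (n + 1)) → ℝ) (l : Fin (n + 1)) :
    tv (fun i => w (permIdx σ i)) l = tv w (σ l) := by
  simp only [tv, tIdx, permIdx_natAdd]

/-- The literal integrand after permuting the fibres: the letters are permuted. [folklore] -/
theorem glit_permIdx {m : ℕ} (p : MvPolynomial (Fin 0) ℚ) (L : Fin m → (Fin 0 → ℚ) × ℚ) (e : Fin m → ℕ)
    (ℓ₁ ℓ₂ : (Fin 0 → ℚ) × ℚ) (n₁ n₂ : ℕ) (a : Fin (n + 1) → Option Cf)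
    (w : Fin (0 + 1 + (n + 1)) → ℝ) :
    glit 0 (n + 1) p L e ℓ₁ ℓ₂ n₁ n₂ a (fun i => w (permIdx σ i)) =
      glit 0 (n + 1) p L e ℓ₁ ℓ₂ n₁ n₂ (fun l => a (σ.symm l)) w := by
  simp only [glit, permIdx_castAdd, permIdx_natAdd]
  congr 1
  exact Fintype.prod_equiv σ _ _ fun l => by simp only [Equiv.symm_apply_apply]

/-- A player seen through the permutation: the fibre `σ⁻¹ j` of the permuted point is the fibre
`j` of the point. [folklore] -/
theorem pv_map_permIdx (u : Fin (n + 1) ⊕ Cf) (w : Fin (0 + 1 + (n + 1)) → ℝ) :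
    pv (u.map σ.symm id) (fun i => w (permIdx σ i)) = pv u w := by
  rcases u with j | c
  · rw [Sum.map_inl, RebaseZero.pv_inl, RebaseZero.pv_inl, tv_permIdx, Equiv.apply_symm_apply]
  · rw [Sum.map_inr, id, RebaseZero.pv_inr, RebaseZero.pv_inr, yv_permIdx]

/-- **The permuted linking pattern.** The permuted point lies in the literal domain with the
bounds transported along `σ` iff the point lies in the literal domain. [folklore] -/
theorem mem_gDom_permIdx {m' : ℕ} (M : Fin m' → Cf) (lo hi : Fin (n + 1) → Fin (n + 1) ⊕ Cf)
    (w : Fin (0 + 1 + (n + 1)) → ℝ) :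
    (fun i => w (permIdx σ i)) ∈ gDom 0 (n + 1) m' M (fun i => (lo (σ i)).map σ.symm id)
        (fun i => (hi (σ i)).map σ.symm id) ↔ w ∈ gDom 0 (n + 1) m' M lo hi := by
  rw [mem_gDom_iff, mem_gDom_iff, yv_permIdx]
  refine and_congr_right fun _ => ⟨fun h k => ?_, fun h i => ?_⟩
  · have := h (σ.symm k)
    rwa [pv_map_permIdx, pv_map_permIdx, tv_permIdx, Equiv.apply_symm_apply] at this
  · rw [pv_map_permIdx, pv_map_permIdx, tv_permIdx]
    exact h (σ i)

/-- Lower bounds of the chain in the order `σ`: the fibre `i` sits at the position `σ i`. -/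
def plo (A : Cf) : Fin (n + 1) → Fin (n + 1) ⊕ Cf := fun i => (clo A (σ i)).map σ.symm id

/-- Upper bounds of the chain in the order `σ`: the fibre `i` sits at the position `σ i`. -/
def phi (Bd : Cf) : Fin (n + 1) → Fin (n + 1) ⊕ Cf := fun i => (chi Bd (σ i)).map σ.symm id

/-! ### Chains in the order `σ` -/

/-- **Chains in an arbitrary order of the fibre indices are good modulo the mixed
configurations.** A representation with a literal `GS 0 (n + 1)` datum (simple base pole) whose
fibres form the chain `A < t_{σ⁻¹ 0} < ⋯ < t_{σ⁻¹ n} < B` and whose letters have the common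
`y`-slope `λ` is good for `GG 0 2 (n + 1) ∪ mixedSet n`: permute the coordinates (rule 2), then
`goodM_cleanChain`. [Kontsevich–Zagier 2001, §1.2, rules (1), (2)] -/
theorem goodM_permChain {m m' n₁ n₂ : ℕ} (s : KZ.IntegralRep (0 + 1 + (n + 1)))
    (M : Fin m' → Cf) (L : Fin m → (Fin 0 → ℚ) × ℚ) (e : Fin m → ℕ) (p : MvPolynomial (Fin 0) ℚ)
    (ℓ₁ ℓ₂ : (Fin 0 → ℚ) × ℚ) (a : Fin (n + 1) → Option Cf) (A Bd : Cf) (h1 : n₁ = 0) (hn : n₂ = 1)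
    (hbd : Bornology.IsBounded s.domain) (hdom : s.domain = gDom 0 (n + 1) m' M (plo σ A) (phi σ Bd))
    (hint : EqOn s.integrand (glit 0 (n + 1) p L e ℓ₁ ℓ₂ n₁ n₂ a) s.domain)
    (lam : ℚ) (ha : ∀ l c, a l = some c → c.1 (Fin.last 0) = lam) : GoodM n (KZ.of s) := by
  set s' := s.reindex (permIdx σ) with hs'
  have hmem : ∀ w, w ∈ s'.domain ↔ (fun i => w (permIdx σ i)) ∈ s.domain := fun w => by
    rw [hs', KZ.IntegralRep.reindex_domain]; rfl
  have hdom' : s'.domain = gDom 0 (n + 1) m' M (clo A) (chi Bd) := by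
    ext w
    rw [hmem, hdom]
    exact mem_gDom_permIdx σ M (clo A) (chi Bd) w
  refine goodM_of_sub_mem (KZ.of_sub_of_reindex_mem_relations s (permIdx σ))
    (goodM_cleanChain s' M L e p ℓ₁ ℓ₂ (fun l => a (σ.symm l)) A Bd h1 hn ?_ hdom' (fun w hw => ?_) lam
      fun l c hc => ha _ c hc)
  · obtain ⟨R, hR⟩ := hbd.exists_norm_le
    rw [isBounded_iff_forall_norm_le]
    refine ⟨R, fun w hw => ?_⟩
    have h1 := hR _ ((hmem w).1 hw)
    refine (pi_norm_le_iff_of_nonneg ((norm_nonneg _).trans h1)).2 fun i => ?_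
    have h2 := norm_le_pi_norm (fun i => w (permIdx σ i)) ((permIdx σ).symm i)
    simp only [Equiv.apply_symm_apply] at h2
    exact h2.trans h1
  · rw [hs', KZ.IntegralRep.reindex_integrand]
    show s.integrand (fun i => w (permIdx σ i)) = _
    rw [hint ((hmem w).1 hw), glit_permIdx]

end RebaseChain

/-- Registered support goal of this file (part of `rebaseSimpleZeroMany_common`), UNCONDITIONAL:
chains `A < t_{σ⁻¹ 0} < ⋯ < t_{σ⁻¹ n} < B` of `n + 1` fibres in an arbitrary order `σ` of the
fibre indices, with letters of a common `y`-slope over a one-dimensional base (literal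
`GS 0 (n + 1)` datum), are congruent modulo `KZ.relations` to the subgroup generated by
`GG 0 2 (n + 1)` and the mixed pinch configurations `RebaseChain.mixedSet n`
(`RebaseChain.goodM_permChain`). -/
theorem rebaseSimpleZeroMany_permChainMixed (n m m' n₁ n₂ : ℕ) (σ : Equiv.Perm (Fin (n + 1))) (s : KZ.IntegralRep (0 + 1 + (n + 1))) (M : Fin m' → (Fin (0 + 1) → ℚ) × ℚ) (L : Fin m → (Fin 0 → ℚ) × ℚ) (e : Fin m → ℕ) (p : MvPolynomial (Fin 0) ℚ) (ℓ₁ ℓ₂ : (Fin 0 → ℚ) × ℚ) (a : Fin (n + 1) → Option ((Fin (0 + 1) → ℚ) × ℚ)) (A Bd : (Fin (0 + 1) → ℚ) × ℚ) (h1 : n₁ = 0) (hn : n₂ = 1) (hbd : Bornology.IsBounded s.domain) (hdom : s.domain = SeparatePos.gDom 0 (n + 1) m' M (RebaseChain.plo σ A) (RebaseChain.phi σ Bd)) (hint : EqOn s.integrand (RebasePos.glit 0 (n + 1) p L e ℓ₁ ℓ₂ n₁ n₂ a) s.domain) (lam : ℚ) (ha : ∀ l c, a l = some c → c.1 (Fin.last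 0) = lam) : ∃ c ∈ AddSubgroup.closure (SeparatePos.GGset 0 2 (n + 1) ∪ RebaseChain.mixedSet n), KZ.of s - c ∈ KZ.relations :=
  RebaseChain.goodM_permChain σ s M L e p ℓ₁ ℓ₂ a A Bd h1 hn hbd hdom hint lam ha

end Summit.KontsevichZagierPeriods.ArrangementNormalForm.JanusBands
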